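import Literature.AlgebraicGeometry.Modules.SheafHomPullbackIso
import Literature.AlgebraicGeometry.Modules.SheafHomPushforward
import Literature.AlgebraicGeometry.Modules.PullbackPushforwardTwist
import Literature.AlgebraicGeometry.Modules.TensorSheafHomIso
import Literature.AlgebraicGeometry.Modules.PullbackDual
import Literature.AlgebraicGeometry.KTheory.PullbackVectorBundle
import HarnessLib

/-!
# The internal-Hom adjunction `𝓗om(A, q_*N) ≅ q_*𝓗om(q^*A, N)` for `A` finite locally free, and the PROJECTION
# FORMULA `q_*(q^*L ⊗ N) ≅ L ⊗ q_*N` for `L` finite locally free and `N` ARBITRARY (Hartshorne II Ex. 5.1 (d);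
# Stacks 01E8)

Layer `Literature/AlgebraicGeometry/Modules`. For ANY morphism of schemes `q : X ⟶ Y`, an `𝒪_Y`-module `A` and an
`𝒪_X`-module `N` there is a canonical morphism

  `c : 𝓗om(A, q_*N) ⟶ q_*𝓗om(q^*A, N)`,  `φ ↦ ε_N| ∘ q^*φ`  (`sheafHomAdjunctionComparison`)

(the tree's `φ ↦ q^*φ` of `Modules/SheafHomPullback` followed by `q_*𝓗om(q^*A, ε_N)`, `ε` the counit of `q^* ⊣ q_*`),
natural in `N`. §2–§3 prove it is an ISOMORPHISM when `A` is finite locally free, by the frame-splitting argument of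
`Modules/SheafHomPullbackIso`: over a frame open `W` of `A`, `𝓗om(A, q_*N)|_W` splits as `⊕_i (q_*N)|_W` (evaluation at
the basis sections ∕ `frameSplit`), and `q_*𝓗om(q^*A, N)|_W` splits likewise through the PULLED-BACK frame of `q^*A`
over `q⁻¹W` transported along `q_*` (`Modules/SheafHomPushforward.pushforwardOverHom`); `c` matches the two splittings
(`c| ≫ P_i = ev_i`, `sp_i ≫ c| = S_i`), so it is invertible over `W`, bijective on sections over the basis of opens inside
frame opens, hence an isomorphism (`Modules/IsoOfSectionsOnBasis`). §4: with the tree's `L ⊗ – ≅ 𝓗om(L^∨, –)` for `L`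
finite locally free (`Modules/TensorSheafHomIso`) and `q^*(L^∨) ≅ (q^*L)^∨` (`Modules/PullbackDual`) this gives the
**projection formula as a natural isomorphism of functors `(q^*L ⊗ –) ⋙ q_* ≅ q_* ⋙ (L ⊗ –)`**
(`projectionFormulaNatIso`; component `projectionFormulaIso q hL N : q_*(q^*L ⊗ N) ≅ L ⊗ q_*N`).

Everything PROVED; 0 named facts; no instances. Not here: `L` merely flat ∕ `N` quasi-coherent with `q` qcqs (Stacks
01E8 in full), compatibility with the monoidal structure maps. Typed for the cell `pub-hodge-ring2` (plate P3 item 3 of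
the (M1) library debt of crux 26512: the translation row of Mukai's (3.1) for `RŜ` needs `p_{Â*}(I• ⊗ p_Â^*P_{−x}) ≅
p_{Â*}I• ⊗ P_{−x}` termwise on an INJECTIVE resolution, i.e. for arbitrary `N`); a research route conditional on HC_CM,
not a corollary — nothing in this file refers to it.

## References

* R. Hartshorne, *Algebraic Geometry* (1977), II Ex. 5.1 (d) (projection formula `f_*(𝓕 ⊗ f^*𝓔) ≅ f_*𝓕 ⊗ 𝓔` for `𝓔`
  locally free of finite rank), II.5 p. 110 (`f^* ⊣ f_*`). [Hartshorne1977]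
* The Stacks Project, Tag 01E8 (Cohomology of sheaves, Lemma 20.54.2 ∕ Modules 17.22: projection formula), Tag 01CM
  (internal Hom). [StacksProject]
* U. Görtz, T. Wedhorn, *Algebraic Geometry I* (2020), (7.8.3), Exercise 7.20 (internal Hom and pull-back ∕ push-forward).
  [GortzWedhorn2020]
-/

noncomputable section

-- `TopCat.Presheaf`/`Scheme.Modules` are not reducible (as in Mathlib's `AlgebraicGeometry/Modules/Sheaf.lean`).
set_option backward.isDefEq.respectTransparency false

open CategoryTheory AlgebraicGeometry Opposite TopologicalSpace Limits

universe u

namespace Literature.AlgebraicGeometry.Modules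

open Literature.AlgebraicGeometry.Motives

/-! ### §1 The comparison `𝓗om(A, q_*N) ⟶ q_*𝓗om(q^*A, N)` and its values -/

section Comparison

variable {X Y : Scheme.{u}} (q : X ⟶ Y) (A : Y.Modules) (N : X.Modules)

/-- **`c : 𝓗om(A, q_*N) ⟶ q_*𝓗om(q^*A, N)`, `φ ↦ ε_N| ∘ q^*φ`** — the sheafified adjunction map of `q^* ⊣ q_*`
(`Modules/SheafHomPullback.sheafHomPullbackTransposeHom` followed by `q_*𝓗om(q^*A, ε_N)`). [cite: GortzWedhorn2020, (7.8.3) and Exercise 7.20]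
[cite: Hartshorne1977, II.5 p. 110] -/
def sheafHomAdjunctionComparison :
    sheafHom A ((Scheme.Modules.pushforward q).obj N) ⟶
      (Scheme.Modules.pushforward q).obj (sheafHom ((Scheme.Modules.pullback q).obj A) N) :=
  sheafHomPullbackTransposeHom q A ((Scheme.Modules.pushforward q).obj N) ≫
    (Scheme.Modules.pushforward q).map
      (sheafHomMap ((Scheme.Modules.pullback q).obj A) ((Scheme.Modules.pullbackPushforwardAdjunction q).counit.app N))

/-- Sections of `c`: `φ ↦ q^*φ ≫ ε_N|_{q⁻¹U}`. [cite: GortzWedhorn2020, (7.8.3) and Exercise 7.20] -/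
theorem sheafHomAdjunctionComparison_app (U : Y.Opens) (φ : A.over U ⟶ ((Scheme.Modules.pushforward q).obj N).over U) :
    (sheafHomAdjunctionComparison q A N).app U φ =
      (pullbackHomOver q φ ≫ (SheafOfModules.overFunctor _ (q ⁻¹ᵁ U)).map
          ((Scheme.Modules.pullbackPushforwardAdjunction q).counit.app N) :
        ((Scheme.Modules.pullback q).obj A).over (q ⁻¹ᵁ U) ⟶ N.over (q ⁻¹ᵁ U)) :=
  rfl

variable {A N} in
/-- **Values of `c(φ)` on pulled-back sections: `c(φ)(η(a)) = φ(a)`** (`(q^*φ)(η(a)) = η(φ(a))` and the triangle identity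
`ε(η(m)) = m` on sections). [cite: Hartshorne1977, II.5 p. 110] [cite: GortzWedhorn2020, (7.8.3)] -/
theorem appLE_sheafHomAdjunctionComparison_app_unitSection {U W : Y.Opens} (φ : A.over U ⟶ ((Scheme.Modules.pushforward q).obj N).over U)
    (k : W ⟶ U) (a : Γ(A, W)) :
    appLE ((sheafHomAdjunctionComparison q A N).app U φ :
        ((Scheme.Modules.pullback q).obj A).over (q ⁻¹ᵁ U) ⟶ N.over (q ⁻¹ᵁ U))
      ((Opens.map q.base).map k) (unitSection q A W a) =
      (appLE φ k a : Γ((Scheme.Modules.pushforward q).obj N, W)) := by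
  change ((Scheme.Modules.pullbackPushforwardAdjunction q).counit.app N).app (q ⁻¹ᵁ W)
      (appLE (pullbackHomOver q φ) ((Opens.map q.base).map k) (unitSection q A W a)) = _
  exact (congrArg (((Scheme.Modules.pullbackPushforwardAdjunction q).counit.app N).app (q ⁻¹ᵁ W))
    (appLE_pullbackHomOver_unitSection (f := q) (φ := φ) k a)).trans (counit_app_unitSection q N W _)

variable {A N} in
/-- `c(φ)(η(a)) = φ(a)` over the whole of `U` (the case `k = 𝟙`). [cite: Hartshorne1977, II.5 p. 110] -/
theorem appLE_sheafHomAdjunctionComparison_app_unitSection_id {U : Y.Opens}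
    (φ : A.over U ⟶ ((Scheme.Modules.pushforward q).obj N).over U) (a : Γ(A, U)) :
    appLE ((sheafHomAdjunctionComparison q A N).app U φ :
        ((Scheme.Modules.pullback q).obj A).over (q ⁻¹ᵁ U) ⟶ N.over (q ⁻¹ᵁ U))
      (𝟙 _) (unitSection q A U a) =
      (appLE φ (𝟙 U) a : Γ((Scheme.Modules.pushforward q).obj N, U)) :=
  (appLE_congr_hom _ (𝟙 _) ((Opens.map q.base).map (𝟙 U)) _).trans
    (appLE_sheafHomAdjunctionComparison_app_unitSection q φ (𝟙 U) a)

variable {N} in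
/-- **Naturality of `c` in `N`**: `𝓗om(A, q_*g) ≫ c_{N'} = c_N ≫ q_*𝓗om(q^*A, g)`. [cite: StacksProject, Tag 01CM] -/
theorem sheafHomAdjunctionComparison_naturality {N' : X.Modules} (g : N ⟶ N') :
    sheafHomMap A ((Scheme.Modules.pushforward q).map g) ≫ sheafHomAdjunctionComparison q A N' =
      sheafHomAdjunctionComparison q A N ≫
        (Scheme.Modules.pushforward q).map (sheafHomMap ((Scheme.Modules.pullback q).obj A) g) := by
  rw [sheafHomAdjunctionComparison, sheafHomAdjunctionComparison, ← Category.assoc,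
    sheafHomPullbackTransposeHom_naturality, Category.assoc, Category.assoc, ← Functor.map_comp, ← Functor.map_comp,
    ← sheafHomMap_comp, ← sheafHomMap_comp, Adjunction.counit_naturality]

end Comparison

/-! ### §2 Over a frame open of `A`, `c` is an isomorphism -/

section OverIso

variable {X Y : Scheme.{u}} (q : X ⟶ Y) {A : Y.Modules} (N : X.Modules) {W V : Y.Opens} {I : Type u} [Fintype I]
  (e : SheafOfModules.free I ≅ A.over W)

/-- `pushforwardOverHom` is compatible with composition. [cite: Hartshorne1977, II.5 (sheaf Hom U ↦ Hom(E|_U, M|_U), p. 109; reading: bookkeeping along direct images)] -/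
theorem pushforwardOverHom_comp {E M P : X.Modules} {U : Y.Opens} (φ₀ : E.over (q ⁻¹ᵁ U) ⟶ M.over (q ⁻¹ᵁ U))
    (ψ₀ : M.over (q ⁻¹ᵁ U) ⟶ P.over (q ⁻¹ᵁ U)) :
    pushforwardOverHom q E P (φ₀ ≫ ψ₀) = pushforwardOverHom q E M φ₀ ≫ pushforwardOverHom q M P ψ₀ :=
  hom_ext_of_appLE fun _ _ _ => rfl

/-- `pushforwardOverHom 𝟙 = 𝟙`. [cite: Hartshorne1977, II.5 (sheaf Hom U ↦ Hom(E|_U, M|_U), p. 109; reading: bookkeeping along direct images)] -/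
theorem pushforwardOverHom_id {E : X.Modules} {U : Y.Opens} :
    pushforwardOverHom q E E (𝟙 (E.over (q ⁻¹ᵁ U))) = 𝟙 _ :=
  hom_ext_of_appLE fun _ _ _ => rfl

/-- `pushforwardOverHom` is compatible with finite sums (a private copy of `Modules/PushforwardTraceTransitive.pushforwardOverHom_sum`,
to keep this file's imports light). [cite: Hartshorne1977, II.5 (sheaf Hom U ↦ Hom(E|_U, M|_U), p. 109; reading: bookkeeping along direct images)] -/
private theorem pushforwardOverHom_sum' {E M : X.Modules} {U : Y.Opens} {ι : Type*} (t : Finset ι)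
    (φ : ι → (E.over (q ⁻¹ᵁ U) ⟶ M.over (q ⁻¹ᵁ U))) :
    pushforwardOverHom q E M (∑ i ∈ t, φ i) = ∑ i ∈ t, pushforwardOverHom q E M (φ i) := by
  classical
  induction t using Finset.induction_on with
  | empty => simp only [Finset.sum_empty, pushforwardOverHom_zero]
  | insert a s ha ih => rw [Finset.sum_insert ha, Finset.sum_insert ha, pushforwardOverHom_add, ih]

/-- `P_i := q_*(ev_{η(b_i)}) : (q_*𝓗om(q^*A, N))|_W ⟶ (q_*N)|_W` — evaluation at the pulled-back basis section, transported
along `q_*`. [cite: Hartshorne1977, II Ex. 5.1 (local frames)] -/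
private def pushP (i : I) :
    ((Scheme.Modules.pushforward q).obj (sheafHom ((Scheme.Modules.pullback q).obj A) N)).over W ⟶
      ((Scheme.Modules.pushforward q).obj N).over W :=
  pushforwardOverHom q _ _ (evalAt (M := N) (basisSection (pullbackFrame q e) i))

/-- `S_i := q_*(sp'_i) : (q_*N)|_W ⟶ (q_*𝓗om(q^*A, N))|_W` — the `i`-th splitting map of the pulled-back frame, transported
along `q_*`. [cite: Hartshorne1977, II Ex. 5.1 (local frames and dual bases)] -/
private def pushS (i : I) :
    ((Scheme.Modules.pushforward q).obj N).over W ⟶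
      ((Scheme.Modules.pushforward q).obj (sheafHom ((Scheme.Modules.pullback q).obj A) N)).over W :=
  pushforwardOverHom q _ _ (frameSplit (pullbackFrame q e) N i)

/-- `Σ_i P_i ≫ S_i = 𝟙` on `(q_*𝓗om(q^*A, N))|_W` (`q_*` of the splitting identity for the pulled-back frame).
[cite: Hartshorne1977, II Ex. 5.1 (local frames and dual bases)] -/
private theorem sum_pushP_comp_pushS : ∑ i, pushP q N e i ≫ pushS q N e i = 𝟙 _ := by
  simp only [pushP, pushS, ← pushforwardOverHom_comp]
  rw [← pushforwardOverHom_sum', sum_evalAt_comp_frameSplit, pushforwardOverHom_id]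

/-- **`c|_W ≫ P_i = ev_{b_i}`**: `c(φ)` evaluated at the pulled-back basis section `η(b_i)` is `φ(b_i)`.
[cite: GortzWedhorn2020, (7.8.3) and Exercise 7.20] -/
private theorem comparison_over_comp_pushP (i : I) :
    (SheafOfModules.overFunctor _ W).map (sheafHomAdjunctionComparison q A N) ≫ pushP q N e i =
      evalAt (M := (Scheme.Modules.pushforward q).obj N) (basisSection e i) := by
  refine hom_ext_of_appLE fun V k (φ : A.over V ⟶ ((Scheme.Modules.pushforward q).obj N).over V) => ?_
  rw [appLE_comp, appLE_over_map, pushP, appLE_pushforwardOverHom, appLE_evalAt, appLE_evalAt,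
    basisSection_pullbackFrame, ← unitSection_map]
  exact appLE_sheafHomAdjunctionComparison_app_unitSection_id q φ _

/-- `q^*`-transport of «multiplication by `m`» evaluated on a pulled-back function: `ε(η(r • m)) = q♯(r) • m|`.
[folklore] -/
private theorem appLE_comparison_smulSection {W' W₀ : Y.Opens} (m : Γ((Scheme.Modules.pushforward q).obj N, W'))
    (k₀ : W₀ ⟶ W') (r : Γ(Y, W₀)) :
    appLE ((sheafHomAdjunctionComparison q (unitModule Y) N).app W' (smulSection m) :
        ((Scheme.Modules.pullback q).obj (unitModule Y)).over (q ⁻¹ᵁ W') ⟶ N.over (q ⁻¹ᵁ W'))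
      ((Opens.map q.base).map k₀) (unitSection q (unitModule Y) W₀ r) =
      q.app W₀ r • (N.presheaf.map ((Opens.map q.base).map k₀).op m : Γ(N, q ⁻¹ᵁ W₀)) := by
  rw [appLE_sheafHomAdjunctionComparison_app_unitSection, appLE_smulSection]
  rfl

/-- **`sp_i ≫ c|_W = S_i`**: `c` of "`λ_i(–) • m`" is "`λ'_i(–) • m`" for the pulled-back frame (`λ'_i(η(a)) = q♯(λ_i(a))`).
[cite: GortzWedhorn2020, (7.8.3) and Exercise 7.20] -/
private theorem frameSplit_comp_comparison_over (i : I) :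
    frameSplit e ((Scheme.Modules.pushforward q).obj N) i ≫
        (SheafOfModules.overFunctor _ W).map (sheafHomAdjunctionComparison q A N) = pushS q N e i := by
  refine hom_ext_of_appLE fun W' k (m : Γ((Scheme.Modules.pushforward q).obj N, W')) => ?_
  rw [appLE_comp, appLE_over_map, appLE_frameSplit, pushS, appLE_pushforwardOverHom, appLE_frameSplit,
    sheafHomAdjunctionComparison_app, pullbackHomOver_comp, Category.assoc]
  -- both sides are morphisms `(q^*A)|_{q⁻¹W'} ⟶ N|_{q⁻¹W'}`; compare on pulled-back sections
  refine hom_ext_of_appLE_unitSection q fun W₀ k₀ (a : Γ(A, W₀)) => ?_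
  have hk : (Opens.map q.base).map k₀ ≫ (Opens.map q.base).map k = (Opens.map q.base).map (k₀ ≫ k) :=
    Subsingleton.elim _ _
  rw [appLE_comp, appLE_pullbackHomOver_unitSection, appLE_restrictHom, ← coord_def,
    ← sheafHomAdjunctionComparison_app, appLE_comparison_smulSection, appLE_comp, appLE_restrictHom, hk, ← coord_def,
    coord_pullbackFrame_unitSection, appLE_smulSection]

/-- The candidate inverse `d := Σ_i P_i ≫ sp_i : (q_*𝓗om(q^*A, N))|_W ⟶ 𝓗om(A, q_*N)|_W`.
[cite: GortzWedhorn2020, (7.8.3) and Exercise 7.20] -/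
def sheafHomAdjunctionComparisonOverInv :
    ((Scheme.Modules.pushforward q).obj (sheafHom ((Scheme.Modules.pullback q).obj A) N)).over W ⟶
      (sheafHom A ((Scheme.Modules.pushforward q).obj N)).over W :=
  ∑ i, pushP q N e i ≫ frameSplit e ((Scheme.Modules.pushforward q).obj N) i

/-- `c|_W ≫ d = 𝟙`. [cite: GortzWedhorn2020, (7.8.3) and Exercise 7.20] -/
theorem adjunctionComparison_over_comp_inv :
    (SheafOfModules.overFunctor _ W).map (sheafHomAdjunctionComparison q A N) ≫
        sheafHomAdjunctionComparisonOverInv q N e = 𝟙 _ := by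
  rw [sheafHomAdjunctionComparisonOverInv, Preadditive.comp_sum]
  simp_rw [← Category.assoc, comparison_over_comp_pushP]
  exact sum_evalAt_comp_frameSplit e ((Scheme.Modules.pushforward q).obj N)

/-- `d ≫ c|_W = 𝟙`. [cite: GortzWedhorn2020, (7.8.3) and Exercise 7.20] -/
theorem inv_comp_adjunctionComparison_over :
    sheafHomAdjunctionComparisonOverInv q N e ≫
        (SheafOfModules.overFunctor _ W).map (sheafHomAdjunctionComparison q A N) = 𝟙 _ := by
  rw [sheafHomAdjunctionComparisonOverInv, Preadditive.sum_comp]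
  simp_rw [Category.assoc, frameSplit_comp_comparison_over]
  exact sum_pushP_comp_pushS q N e

include e in
/-- **Over a frame open of `A`, the comparison is an isomorphism.** [cite: GortzWedhorn2020, (7.8.3) and Exercise 7.20] -/
theorem isIso_sheafHomAdjunctionComparison_over :
    IsIso ((SheafOfModules.overFunctor _ W).map (sheafHomAdjunctionComparison q A N)) :=
  ⟨sheafHomAdjunctionComparisonOverInv q N e, adjunctionComparison_over_comp_inv q N e, inv_comp_adjunctionComparison_over q N e⟩

end OverIso

/-! ### §3 `c` is an isomorphism for `A` finite locally free -/

section Iso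

variable {X Y : Scheme.{u}} (q : X ⟶ Y) {A : Y.Modules}

/-- The values of an isomorphism of restricted modules are bijections. [folklore] -/
private theorem appLE_bijective_of_isIso' {P Q : Y.Modules} {W V : Y.Opens} (χ : P.over W ⟶ Q.over W) [IsIso χ]
    (k : V ⟶ W) : Function.Bijective (appLE χ k) := by
  refine ⟨fun s t h => ?_, fun t => ⟨appLE (inv χ) k t, ?_⟩⟩
  · have h' := congrArg (appLE (inv χ) k) h
    rwa [← appLE_comp, ← appLE_comp, IsIso.hom_inv_id, appLE_id, appLE_id] at h'
  · rw [← appLE_comp, IsIso.inv_hom_id, appLE_id]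

/-- **`𝓗om(A, q_*N) ⟶ q_*𝓗om(q^*A, N)` IS AN ISOMORPHISM FOR `A` FINITE LOCALLY FREE**, for every morphism of
schemes `q` and every `𝒪_X`-module `N`: bijective on sections over the basis of opens inside trivialising opens
(`isIso_sheafHomAdjunctionComparison_over`), hence an isomorphism. [cite: GortzWedhorn2020, (7.8.3) and Exercise 7.20]
[cite: Hartshorne1977, II Ex. 5.1 (b), (d)] -/
theorem isIso_sheafHomAdjunctionComparison (hA : IsFiniteLocallyFree A) (N : X.Modules) :
    IsIso (sheafHomAdjunctionComparison q A N) := by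
  refine isIso_of_bijective_on_basis _ (isBasis_setOf_le_framed A hA) fun V hV => ?_
  obtain ⟨W, k, I, hI, ⟨e⟩⟩ := hV
  haveI := Fintype.ofFinite I
  haveI := isIso_sheafHomAdjunctionComparison_over q N e
  exact appLE_bijective_of_isIso' ((SheafOfModules.overFunctor _ W).map (sheafHomAdjunctionComparison q A N)) k

/-- **`𝓗om(A, q_*N) ≅ q_*𝓗om(q^*A, N)` for `A` finite locally free.** [cite: GortzWedhorn2020, (7.8.3) and Exercise 7.20]
[cite: Hartshorne1977, II Ex. 5.1 (b), (d)] -/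
def sheafHomAdjunctionIso (hA : IsFiniteLocallyFree A) (N : X.Modules) :
    sheafHom A ((Scheme.Modules.pushforward q).obj N) ≅
      (Scheme.Modules.pushforward q).obj (sheafHom ((Scheme.Modules.pullback q).obj A) N) :=
  haveI := isIso_sheafHomAdjunctionComparison q hA N
  asIso (sheafHomAdjunctionComparison q A N)

/-- **`q_* ⋙ 𝓗om(A, –) ≅ 𝓗om(q^*A, –) ⋙ q_*` for `A` finite locally free**, natural in the `𝒪_X`-module.
[cite: GortzWedhorn2020, (7.8.3) and Exercise 7.20] -/
def sheafHomAdjunctionNatIso (hA : IsFiniteLocallyFree A) :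
    Scheme.Modules.pushforward q ⋙ sheafHomFunctor A ≅
      sheafHomFunctor ((Scheme.Modules.pullback q).obj A) ⋙ Scheme.Modules.pushforward q :=
  NatIso.ofComponents (fun N => sheafHomAdjunctionIso q hA N) (fun g => sheafHomAdjunctionComparison_naturality q A g)

end Iso

/-! ### §4 The projection formula `q_*(q^*L ⊗ N) ≅ L ⊗ q_*N` for `L` finite locally free -/

section Projection

variable {X Y : Scheme.{u}} (q : X ⟶ Y) {L : Y.Modules} (hL : IsFiniteLocallyFree L)

/-- `𝓗om(E₁, –) ≅ 𝓗om(E₂, –)` from an isomorphism `E₁ ≅ E₂` (natural in the second variable). [cite: Hartshorne1977, II Ex. 1.15 and II.5 p. 109 (functoriality of sheaf Hom)] -/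
def sheafHomFunctorLeftIso {Z : Scheme.{u}} {E₁ E₂ : Z.Modules} (i : E₁ ≅ E₂) : sheafHomFunctor E₁ ≅ sheafHomFunctor E₂ :=
  NatIso.ofComponents (fun N => sheafHomMapLeftIso i N) (fun {_ N} g => sheafHomMapLeft_sheafHomMap N i.inv g)

/-- **THE PROJECTION FORMULA as a natural isomorphism of functors `(q^*L ⊗ –) ⋙ q_* ≅ q_* ⋙ (L ⊗ –)`** for `L` finite
locally free on `Y` (`N ↦ q_*(q^*L ⊗ N) ≅ L ⊗ q_*N`, `N` an ARBITRARY `𝒪_X`-module): `q^*L ⊗ – ≅ 𝓗om((q^*L)^∨, –) ≅ 𝓗om(q^*(L^∨), –)`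
on `X`, the adjunction isomorphism of §3 for `A = L^∨`, and `𝓗om(L^∨, –) ≅ L ⊗ –` on `Y`. [cite: Hartshorne1977, II Ex. 5.1 (d)]
[cite: StacksProject, Tag 01E8] -/
def projectionFormulaNatIso :
    (tensorBifunctor X).obj ((Scheme.Modules.pullback q).obj L) ⋙ Scheme.Modules.pushforward q ≅
      Scheme.Modules.pushforward q ⋙ (tensorBifunctor Y).obj L :=
  Functor.isoWhiskerRight
      (tensorSheafHomDualNatIso ((Scheme.Modules.pullback q).obj L) (hL.pullback q) ≪≫
        sheafHomFunctorLeftIso (pullbackDualIso q hL).symm) (Scheme.Modules.pushforward q) ≪≫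
    (sheafHomAdjunctionNatIso q (isFiniteLocallyFree_dual hL)).symm ≪≫
    Functor.isoWhiskerLeft (Scheme.Modules.pushforward q) (tensorSheafHomDualNatIso L hL).symm

/-- **The projection formula `q_*(q^*L ⊗ N) ≅ L ⊗ q_*N`** for `L` finite locally free and `N` an arbitrary `𝒪_X`-module
(component of `projectionFormulaNatIso`). [cite: Hartshorne1977, II Ex. 5.1 (d)] [cite: StacksProject, Tag 01E8] -/
def projectionFormulaIso (N : X.Modules) :
    (Scheme.Modules.pushforward q).obj (tensorObj ((Scheme.Modules.pullback q).obj L) N) ≅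
      tensorObj L ((Scheme.Modules.pushforward q).obj N) :=
  (projectionFormulaNatIso q hL).app N

/-- Naturality of the projection formula in `N`. [cite: Hartshorne1977, II Ex. 5.1 (d)] -/
@[reassoc]
theorem projectionFormulaIso_hom_naturality {N N' : X.Modules} (g : N ⟶ N') :
    (Scheme.Modules.pushforward q).map (tensorMap (𝟙 _) g) ≫ (projectionFormulaIso q hL N').hom =
      (projectionFormulaIso q hL N).hom ≫ tensorMap (𝟙 L) ((Scheme.Modules.pushforward q).map g) :=
  (projectionFormulaNatIso q hL).hom.naturality g

end Projection

end Literature.AlgebraicGeometry.Modules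

end
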